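import Mathlib.Analysis.Asymptotics.Defs
import Mathlib.Analysis.SpecialFunctions.Log.Basic
import Mathlib.Logic.Function.DependsOn
import Mathlib.Algebra.BigOperators.Fin
import Mathlib.Data.Fintype.BigOperators
import HarnessLib

/-!
# Strong low-degree hardness of random `k`-SAT (Huang–Sellke 2025, Cor. 3.21) — named fact

Topic `Literature/Computability/Complexity` (random `k`-SAT files `RandomKSat*.lean`). Vocabulary and
ONE named fact (D-0014, statement only):

* `IsCoordDegreeLE D F` — *coordinate degree* `≤ D` of a real function on a product space
  `ι → Γ`: `F` is a finite sum of functions each depending on at most `D` coordinates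
  (`Function.DependsOn`). This is Huang–Sellke's "degree `D` function on `Γ^d`" (arXiv:2501.06427
  §3.3, p. 21: *the span of all functions `∏_{i ∈ I} f_i(y_i)` with `|I| ≤ D` and `f_i : Γ → ℝ`
  arbitrary … a slightly more general notion than a degree `D` polynomial*), i.e. Efron–Stein /
  Hoeffding (functional ANOVA) degree `≤ D`; on the Boolean cube it is Fourier–Walsh degree `≤ D`.
  Basic closure properties (`zero`, `add`, `neg`, `smul`, `sum`, `mono`, `of_dependsOn`) are proved.
* `litArrayOfBits m k j` — the bit decoding of a literal array over `n = 2^j` variables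
  (`j` index bits + 1 sign bit per literal slot), a bijection from the uniform cube
  `Fin (m·k·(j+1)) → Bool` onto `F_k(2^j, m)`; used to let Boolean circuits read random `k`-SAT
  instances in the with-replacement literal model (`Fin m → Fin k → Fin n × Bool`,
  `RandomKSatThreshold.lean`).
* `HuangSellke2025KSat` — **Huang–Sellke 2025, Corollary 3.21** (strong low-degree hardness of
  random `k`-SAT, based on Bresler–Huang 2021), in the deterministic, saturated-output special case
  at `κ = 5`: for all large `k`, at clause density `α_k = 5 · 2^k log k / k`, every sequence of
  vector-valued functions of coordinate degree `o(n)` and energy `O(n)` on `F_k(n, ⌊α_k n⌋)` has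
  probability `→ 0` that all its output coordinates have modulus `≥ 1` and their signs form a
  satisfying assignment.

## Faithfulness notes (read at the page, arXiv:2501.06427v1)

Model (p. 23, §3.3.2): *`N` Boolean variables, `M` IID clauses with `M/N → α`, each clause a
disjunction of `k` IID literals uniform on `Γ = {x_1, …, x_N, x̄_1, …, x̄_N}`; an instance is a sample
`y ∼ μ^{⊗ kM}`* — this is exactly the tree's literal-array model `Fin m → Fin k → Fin n × Bool`
(literal `(v, b)` true under `σ` iff `σ v = b`), with `M = ⌊α N⌋`. Printed statement: *for any
`κ > κ* ≈ 4.911` there is `k_*(κ)` such that for all `k ≥ k_*(κ)` and `α = κ 2^k log k / k`: if `A°`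
is a degree `D = o(N)` function with `E‖A°(y, ω)‖² ≤ CN`, then
`P[round_U(A°(y, ω)) is a satisfying assignment of y] = o_N(1)`*, where (p. 4)
`round_U(x)_v = 1` if `x_v ≥ U_v` and `-1` otherwise, `U ∼ Unif([-1,1]^N)` independent, `+1 ≙ true`.
Specialisation recorded here: `κ = 5`; no internal randomness `ω`; and the event is intersected
with `{∀ v, |A°_v| ≥ 1}`, on which `round_U(A°) = sgn(A°)` for every `U ∈ (-1, 1]^N` (a set of
full measure), so `P_y[saturated ∧ sign assignment satisfies] ≤ P_{y,U}[round_U(A°) satisfies]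
= o(1)`. Probabilities are counting ratios; "`= o_N(1)`" is rendered "`≤ ε · #univ` eventually, for
every `ε > 0`", for each fixed admissible sequence.
`-- TODO(general form):` randomized rounding `round_U` and internal randomness `ω`; every
`κ > κ*` (needs the constant `κ*` of Bresler–Huang 2021, Thm. 2.6).

## References

* B. Huang, M. Sellke, *Strong low degree hardness for stable local optima in spin glasses*,
  arXiv:2501.06427 (2025), §3.3.2, Corollary 3.21, Lemma 3.22 [HuangSellke2025].
* G. Bresler, B. Huang, *The algorithmic phase transition of random k-SAT for low degree
  polynomials*, FOCS 2021 / arXiv:2106.02129, Def. 2.1–2.2, Thm. 2.6 [BreslerHuang2022].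
-/

noncomputable section

namespace Literature.Computability.Complexity

open Finset Filter Asymptotics
open scoped Classical

/-! ### Coordinate degree on a product space -/

/-- **Coordinate degree `≤ D`** of `F : (ι → Γ) → ℝ` (Huang–Sellke 2025 §3.3, "degree `D`
function on `Γ^d`": the span of the products `∏_{i∈I} f_i(y_i)`, `|I| ≤ D`; equivalently a finite
sum of `D`-juntas; = Efron–Stein/Hoeffding degree `≤ D`): there are finitely many coordinate sets
`T`, each of size `≤ D`, and functions `G_T` depending only on the coordinates in `T`, with
`F = ∑_T G_T`. [cite: HuangSellke2025, §3.3 (arXiv:2501.06427 p. 21)] -/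
def IsCoordDegreeLE {ι Γ : Type*} (D : ℕ) (F : (ι → Γ) → ℝ) : Prop :=
  ∃ (S : Finset (Finset ι)) (G : Finset ι → (ι → Γ) → ℝ),
    (∀ T ∈ S, T.card ≤ D ∧ DependsOn (G T) (↑T : Set ι)) ∧ ∀ y, F y = ∑ T ∈ S, G T y

namespace IsCoordDegreeLE

variable {ι Γ : Type*}

/-- A function depending on a set of at most `D` coordinates has coordinate degree `≤ D`. [folklore] -/
theorem of_dependsOn {D : ℕ} {F : (ι → Γ) → ℝ} (T : Finset ι) (hT : T.card ≤ D)
    (hF : DependsOn F (↑T : Set ι)) : IsCoordDegreeLE D F :=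
  ⟨{T}, fun _ => F, fun T' hT' => by rw [mem_singleton.1 hT']; exact ⟨hT, hF⟩, fun y => by simp⟩

/-- The zero function has every coordinate degree. [folklore] -/
theorem zero (D : ℕ) : IsCoordDegreeLE D (fun _ : ι → Γ => (0 : ℝ)) :=
  ⟨∅, fun _ _ => 0, fun _ h => absurd h (by simp), fun _ => by simp⟩

/-- Constants have every coordinate degree. [folklore] -/
theorem const (D : ℕ) (c : ℝ) : IsCoordDegreeLE D (fun _ : ι → Γ => c) :=
  of_dependsOn ∅ (by simp) (fun _ _ _ => rfl)

/-- Coordinate degree is monotone in the bound. [folklore] -/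
theorem mono {D D' : ℕ} {F : (ι → Γ) → ℝ} (h : IsCoordDegreeLE D F) (hDD' : D ≤ D') :
    IsCoordDegreeLE D' F := by
  obtain ⟨S, G, hS, hF⟩ := h
  exact ⟨S, G, fun T hT => ⟨(hS T hT).1.trans hDD', (hS T hT).2⟩, hF⟩

/-- Scalar multiples. [folklore] -/
theorem smul {D : ℕ} {F : (ι → Γ) → ℝ} (h : IsCoordDegreeLE D F) (c : ℝ) :
    IsCoordDegreeLE D (fun y => c * F y) := by
  obtain ⟨S, G, hS, hF⟩ := h
  refine ⟨S, fun T y => c * G T y, fun T hT => ⟨(hS T hT).1, fun y y' hyy' => ?_⟩, fun y => ?_⟩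
  · simp only [(hS T hT).2 hyy']
  · show c * F y = ∑ T ∈ S, c * G T y
    rw [hF y, mul_sum]

/-- Negation. [folklore] -/
theorem neg {D : ℕ} {F : (ι → Γ) → ℝ} (h : IsCoordDegreeLE D F) :
    IsCoordDegreeLE D (fun y => -F y) := by
  simpa using h.smul (-1)

/-- Sums of two. [folklore] -/
theorem add {D : ℕ} {F₁ F₂ : (ι → Γ) → ℝ} (h₁ : IsCoordDegreeLE D F₁) (h₂ : IsCoordDegreeLE D F₂) :
    IsCoordDegreeLE D (fun y => F₁ y + F₂ y) := by
  obtain ⟨S₁, G₁, hS₁, hF₁⟩ := h₁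
  obtain ⟨S₂, G₂, hS₂, hF₂⟩ := h₂
  refine ⟨S₁ ∪ S₂, fun T y => (if T ∈ S₁ then G₁ T y else 0) + (if T ∈ S₂ then G₂ T y else 0),
    fun T hT => ⟨?_, fun y y' hyy' => ?_⟩, fun y => ?_⟩
  · rcases mem_union.1 hT with h | h
    · exact (hS₁ T h).1
    · exact (hS₂ T h).1
  · show (if T ∈ S₁ then G₁ T y else 0) + (if T ∈ S₂ then G₂ T y else 0) =
      (if T ∈ S₁ then G₁ T y' else 0) + (if T ∈ S₂ then G₂ T y' else 0)
    congr 1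
    · split_ifs with h
      · exact (hS₁ T h).2 hyy'
      · rfl
    · split_ifs with h
      · exact (hS₂ T h).2 hyy'
      · rfl
  · show F₁ y + F₂ y = ∑ T ∈ S₁ ∪ S₂, ((if T ∈ S₁ then G₁ T y else 0) + (if T ∈ S₂ then G₂ T y else 0))
    rw [hF₁ y, hF₂ y, sum_add_distrib, sum_ite_mem, sum_ite_mem, union_comm S₁ S₂,
      inter_eq_right.2 subset_union_right, union_comm S₂ S₁, inter_eq_right.2 subset_union_right]

/-- Finite sums. [folklore] -/
theorem sum {D : ℕ} {α : Type*} (s : Finset α) {F : α → (ι → Γ) → ℝ}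
    (h : ∀ a ∈ s, IsCoordDegreeLE D (F a)) : IsCoordDegreeLE D (fun y => ∑ a ∈ s, F a y) := by
  induction s using Finset.induction_on with
  | empty => simpa using zero D
  | insert a s ha ih =>
    have h' := (h a (mem_insert_self a s)).add (ih fun b hb => h b (mem_insert_of_mem hb))
    simpa [sum_insert ha] using h'

end IsCoordDegreeLE

/-! ### Bit decoding of literal arrays over `2^j` variables -/

/-- **Bit decoding of a literal array over `n = 2^j` variables.** Input bit `i < m·k·(j+1)` is bit
`t` of literal slot `(a, b)` under `Fin (m·k·(j+1)) ≃ (Fin m × Fin k) × Fin (j+1)`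
(`finProdFinEquiv`); the bits `t < j` of a slot are the binary digits of the variable index
(`finFunctionFinEquiv`), bit `j` is the sign. A bijection
`(Fin (m·k·(j+1)) → Bool) ≃ (Fin m → Fin k → Fin (2^j) × Bool)`, so the uniform measure on the cube
is the with-replacement literal model `F_k(2^j, m)` of `RandomKSatThreshold.lean`; each literal
depends only on the `j+1` bits of its own slot. [folklore] -/
def litArrayOfBits (m k j : ℕ) (x : Fin (m * k * (j + 1)) → Bool) :
    Fin m → Fin k → Fin (2 ^ j) × Bool :=
  fun a b =>
    (finFunctionFinEquiv (m := 2) (n := j)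
        (fun t : Fin j => if x (finProdFinEquiv (finProdFinEquiv (a, b), t.castSucc)) then 1 else 0),
      x (finProdFinEquiv (finProdFinEquiv (a, b), Fin.last j)))

/-! ### The named fact -/

/-- **Huang–Sellke 2025, Corollary 3.21 — strong low-degree hardness of random `k`-SAT**
(based on Bresler–Huang 2021), `κ = 5`, deterministic saturated special case. There is `k₀` such
that for every `k ≥ k₀`, every `C > 0`, every degree sequence `D_n = o(n)` and every sequence of
functions `F_n : (Fin m → Fin k → Fin n × Bool) → (Fin n → ℝ)`, `m = ⌊5 · 2^k log k / k · n⌋`, whose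
output coordinates have coordinate degree `≤ D_n` in the `m·k` literal coordinates and whose energy
is `∑_Φ ∑_v F_n(Φ)_v² ≤ C · n · #Φ`: for every `ε > 0`, eventually in `n`, the number of literal arrays
`Φ` on which every `|F_n(Φ)_v| ≥ 1` AND the sign assignment `v ↦ (0 ≤ F_n(Φ)_v)` satisfies `Φ` is
at most `ε · #Φ`. Printed form: `P[round_U(A°(y, ω)) satisfies y] = o_N(1)` for degree-`o(N)` `A°`
with `E‖A°‖² ≤ CN`, any `κ > κ* ≈ 4.911`, `k ≥ k_*(κ)`, `α = κ 2^k log k / k`, `M/N → α`,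
`U ∼ Unif([-1,1]^N)`; on `{∀ v, |A°_v| ≥ 1}` one has `round_U(A°) = sgn A°` for all `U ∈ (-1,1]^N`,
whence this special case (module docstring). Users take `(h : HuangSellke2025KSat)`.
[cite: HuangSellke2025, Cor. 3.21 (arXiv:2501.06427 §3.3.2 p. 23)] -/
def HuangSellke2025KSat : Prop :=
  ∃ k₀ : ℕ, ∀ k : ℕ, k₀ ≤ k → ∀ C : ℝ, 0 < C → ∀ D : ℕ → ℕ,
    (fun n : ℕ => (D n : ℝ)) =o[atTop] (fun n : ℕ => (n : ℝ)) →
    ∀ F : (n : ℕ) → (m : ℕ) → (Fin m → Fin k → Fin n × Bool) → Fin n → ℝ,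
      (∀ (n m : ℕ) (v : Fin n), IsCoordDegreeLE (D n)
          (fun y : Fin m × Fin k → Fin n × Bool => F n m (Function.curry y) v)) →
      (∀ n m : ℕ, m = ⌊5 * 2 ^ k * Real.log k / k * n⌋₊ →
          ∑ Φ : Fin m → Fin k → Fin n × Bool, ∑ v : Fin n, F n m Φ v ^ 2
            ≤ C * n * Fintype.card (Fin m → Fin k → Fin n × Bool)) →
      ∀ ε : ℝ, 0 < ε → ∀ᶠ n : ℕ in atTop, ∀ m : ℕ, m = ⌊5 * 2 ^ k * Real.log k / k * n⌋₊ →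
        ((univ.filter fun Φ : Fin m → Fin k → Fin n × Bool =>
            (∀ v : Fin n, 1 ≤ |F n m Φ v|) ∧
            ∀ i : Fin m, ∃ j : Fin k, decide (0 ≤ F n m Φ (Φ i j).1) = (Φ i j).2).card : ℝ)
          ≤ ε * Fintype.card (Fin m → Fin k → Fin n × Bool)
-- TODO(general form): randomized rounding `round_U`, internal randomness `ω`, every `κ > κ*`.

/-! ### The bit decoding is a bijection (API for `litArrayOfBits`)

Appended 2026-08-16 (prover-line-stmt-PneNP-2460-0): the inverse encoding `bitsOfLitArray`, the
two round trips, the resulting equivalence `litArrayEquiv` (so the uniform cube IS `F_k(2^j, m)`),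
slot-locality of the bits, and `#F_k(2^j, m) = 2^{m k (j+1)}`. Everything is proved. -/

section BitEncoding

variable (m k j : ℕ)

/-- The literal slot `(a, b) ∈ Fin m × Fin k` that input bit `i` belongs to (first component of
`Fin (m·k·(j+1)) ≃ Fin (m·k) × Fin (j+1)`, then `Fin (m·k) ≃ Fin m × Fin k`). [folklore] -/
def litArrayBitSlot (i : Fin (m * k * (j + 1))) : Fin m × Fin k :=
  finProdFinEquiv.symm (finProdFinEquiv.symm i).1

/-- The position `t ≤ j` of input bit `i` inside its slot (`t < j`: binary digit `t` of the
variable index; `t = j`: the sign bit). [folklore] -/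
def litArrayBitPos (i : Fin (m * k * (j + 1))) : Fin (j + 1) :=
  (finProdFinEquiv.symm i).2

/-- **The inverse encoding**: the `m·k·(j+1)` bits of a literal array over `2^j` variables (digit
`t < j` of slot `(a, b)` is digit `t` of the variable index `(Φ a b).1` under `finFunctionFinEquiv`,
bit `j` is the sign `(Φ a b).2`). [folklore] -/
def bitsOfLitArray (Φ : Fin m → Fin k → Fin (2 ^ j) × Bool) : Fin (m * k * (j + 1)) → Bool :=
  fun i =>
    if h : ((litArrayBitPos m k j i : ℕ)) < j then
      decide (finFunctionFinEquiv.symm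
        (Φ (litArrayBitSlot m k j i).1 (litArrayBitSlot m k j i).2).1 ⟨_, h⟩ = 1)
    else (Φ (litArrayBitSlot m k j i).1 (litArrayBitSlot m k j i).2).2

variable {m k j}

/-- The slot of the bit at slot `(a, b)`, position `t`. [folklore] -/
theorem litArrayBitSlot_mk (a : Fin m) (b : Fin k) (t : Fin (j + 1)) :
    litArrayBitSlot m k j (finProdFinEquiv (finProdFinEquiv (a, b), t)) = (a, b) := by
  simp [litArrayBitSlot]

/-- The position of the bit at slot `(a, b)`, position `t`. [folklore] -/
theorem litArrayBitPos_mk (a : Fin m) (b : Fin k) (t : Fin (j + 1)) :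
    litArrayBitPos m k j (finProdFinEquiv (finProdFinEquiv (a, b), t)) = t := by
  simp [litArrayBitPos]

/-- A bit is determined by its slot and position. [folklore] -/
theorem finProdFinEquiv_litArrayBitSlot_litArrayBitPos (i : Fin (m * k * (j + 1))) :
    finProdFinEquiv (finProdFinEquiv (litArrayBitSlot m k j i), litArrayBitPos m k j i) = i := by
  simp only [litArrayBitSlot, litArrayBitPos, Equiv.apply_symm_apply, Prod.mk.eta]

/-- **Slot-locality**: each bit of the inverse encoding depends only on the literal in its own
slot. [folklore] -/
theorem bitsOfLitArray_eq_of_slot_eq {Φ Ψ : Fin m → Fin k → Fin (2 ^ j) × Bool}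
    {i : Fin (m * k * (j + 1))}
    (h : Φ (litArrayBitSlot m k j i).1 (litArrayBitSlot m k j i).2 =
      Ψ (litArrayBitSlot m k j i).1 (litArrayBitSlot m k j i).2) :
    bitsOfLitArray m k j Φ i = bitsOfLitArray m k j Ψ i := by
  simp only [bitsOfLitArray, h]

/-- `Fin 2` read as a bit and written back. [folklore] -/
theorem fin_two_ite_eq_one_eq_self (z : Fin 2) : (if z = 1 then (1 : Fin 2) else 0) = z := by
  revert z; decide

/-- **Round trip**: decoding the bits of a literal array gives the array back. [folklore] -/
theorem litArrayOfBits_bitsOfLitArray (Φ : Fin m → Fin k → Fin (2 ^ j) × Bool) :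
    litArrayOfBits m k j (bitsOfLitArray m k j Φ) = Φ := by
  funext a b
  have h1 : (fun t : Fin j => (if bitsOfLitArray m k j Φ
      (finProdFinEquiv (finProdFinEquiv (a, b), t.castSucc)) then (1 : Fin 2) else 0)) =
      finFunctionFinEquiv.symm (Φ a b).1 := by
    funext t
    have hlt : ((litArrayBitPos m k j
        (finProdFinEquiv (finProdFinEquiv (a, b), t.castSucc)) : ℕ)) < j := by
      rw [litArrayBitPos_mk, Fin.val_castSucc]; exact t.isLt
    rw [bitsOfLitArray, dif_pos hlt]
    have ht : (⟨((litArrayBitPos m k j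
        (finProdFinEquiv (finProdFinEquiv (a, b), t.castSucc)) : ℕ)), hlt⟩ : Fin j) = t := by
      ext; simp only [litArrayBitPos_mk, Fin.val_castSucc]
    rw [ht, litArrayBitSlot_mk]
    simp only [decide_eq_true_eq]
    exact fin_two_ite_eq_one_eq_self _
  have h2 : bitsOfLitArray m k j Φ (finProdFinEquiv (finProdFinEquiv (a, b), Fin.last j)) =
      (Φ a b).2 := by
    have hnlt : ¬ ((litArrayBitPos m k j
        (finProdFinEquiv (finProdFinEquiv (a, b), Fin.last j)) : ℕ)) < j := by
      rw [litArrayBitPos_mk, Fin.val_last]; exact lt_irrefl j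
    rw [bitsOfLitArray, dif_neg hnlt, litArrayBitSlot_mk]
  simp only [litArrayOfBits, h1, h2, Equiv.apply_symm_apply]

/-- **Round trip**: encoding the decoded literal array gives the bits back. [folklore] -/
theorem bitsOfLitArray_litArrayOfBits (x : Fin (m * k * (j + 1)) → Bool) :
    bitsOfLitArray m k j (litArrayOfBits m k j x) = x := by
  funext i
  by_cases hlt : ((litArrayBitPos m k j i : ℕ)) < j
  · rw [bitsOfLitArray, dif_pos hlt]
    simp only [litArrayOfBits, Equiv.symm_apply_apply]
    have : (⟨(litArrayBitPos m k j i : ℕ), hlt⟩ : Fin j).castSucc = litArrayBitPos m k j i := by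
      ext; simp only [Fin.val_castSucc]
    rw [this, finProdFinEquiv_litArrayBitSlot_litArrayBitPos]
    cases x i <;> simp
  · rw [bitsOfLitArray, dif_neg hlt]
    simp only [litArrayOfBits]
    have : Fin.last j = litArrayBitPos m k j i := by
      ext
      have := (litArrayBitPos m k j i).isLt
      rw [Fin.val_last]; omega
    rw [this, finProdFinEquiv_litArrayBitSlot_litArrayBitPos]

/-- The bit decoding is injective. [folklore] -/
theorem litArrayOfBits_injective : Function.Injective (litArrayOfBits m k j) := fun x y h => by
  rw [← bitsOfLitArray_litArrayOfBits x, ← bitsOfLitArray_litArrayOfBits y, h]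

/-- The bit encoding is injective. [folklore] -/
theorem bitsOfLitArray_injective :
    Function.Injective (bitsOfLitArray m k j : (Fin m → Fin k → Fin (2 ^ j) × Bool) → _) :=
  fun Φ Ψ h => by rw [← litArrayOfBits_bitsOfLitArray Φ, ← litArrayOfBits_bitsOfLitArray Ψ, h]

variable (m k j) in
/-- **The bit decoding as an equivalence** `(Fin (m·k·(j+1)) → Bool) ≃ F_k(2^j, m)`: the uniform
cube is the with-replacement literal model over `2^j` variables. [folklore] -/
def litArrayEquiv : (Fin (m * k * (j + 1)) → Bool) ≃ (Fin m → Fin k → Fin (2 ^ j) × Bool) where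
  toFun := litArrayOfBits m k j
  invFun := bitsOfLitArray m k j
  left_inv := bitsOfLitArray_litArrayOfBits
  right_inv := litArrayOfBits_bitsOfLitArray

/-- `#F_k(2^j, m) = 2^{m k (j+1)}`. [folklore] -/
theorem card_litArray_two_pow (m k j : ℕ) :
    Fintype.card (Fin m → Fin k → Fin (2 ^ j) × Bool) = 2 ^ (m * k * (j + 1)) := by
  rw [← Fintype.card_congr (litArrayEquiv m k j)]
  simp

end BitEncoding

end Literature.Computability.Complexity

end
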